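import Summits.AtomisticToContinuum.FouriersLaw.Theorems.VanishingNoiseTransferNoiseLocalityStubResponseDensityNoisyAux2
import Summits.AtomisticToContinuum.FouriersLaw.Theorems.OddSectorIrreversibilityOddDensityIsCorrectorDensity
import Summits.AtomisticToContinuum.FouriersLaw.Theorems.OddSectorIrreversibilityCorrectorTheoryEnergy
import Literature.MathematicalPhysics.KineticTheory.VelocityFlipNoise

/-!
# Weak `L²(μ_T)` solutions for the flip-noisy generator are flip-invariant
(helpers for stub `stub_responseDensityNoisy`)

Helper file `--supports stmt-AtomisticToContinuum-11975` (crux `NoiseLocality`, route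
`VanishingNoiseTransfer`, line `relative-flip-energy-transfer`, stub 1b `stub_responseDensityNoisy`).

The `L²(μ_T)`-uniqueness input (U) of the compactness reduction (`…StubResponseDensityNoisyAux3`,
`of_apriori_of_unique`) concerns `k ∈ L²(μ_T)` with `∫ (L_{T,T} f + ε S f) k dμ_T = 0` for all
`f ∈ C_c^∞` (`S` the velocity-flip generator, `ε > 0`). This file removes the noise from that
equation WITHOUT any construction of the flip-noisy dynamics: such a `k` has ZERO FLIP ENERGY,
`∫ (k∘Θ_i - k)² dμ_T = 0` for every site `i` (`flipEnergy_eq_zero_of_weak`, registered helper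
`helper_responseDensityNoisyFlipEnergyZero`), hence (next file) it is
flip-invariant, `S k = 0`, and it solves the DETERMINISTIC weak equation `∫ (L_{T,T} f) k dμ_T = 0`.

Proof (pinned chain, `N ≥ 2`, `γ > 0`, in `H = L²(μ_T)`): let `λ = 2Nε + 1` and `y = λk + εSk`.
By the essential m-dissipativity of the equilibrium generator on test functions PROVED in the tree
(`OddSectorIrreversibility.exists_testFunction_resolvent_approx`: `(λ - L)C_c^∞` is dense) there are
test functions `F_n` with `λF_n - LF_n → y`; dissipativity `∫ (LF)F dμ_T ≤ 0`
(`integral_generator_mul_self_nonpos`, from the tap energy identity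
`Corrector.integral_mul_source_eq_dirichlet`) gives `λ‖F‖ ≤ ‖λF - LF‖` (`resolvent_lower_bound`), so
`F_n` is Cauchy, `F_n → x` with `λ‖x‖ ≤ ‖y‖`. Testing the weak equation with `F_n` and using the
symmetry of `S` (`integral_mul_flipNoise`) gives in the limit `⟨x, y⟩ = ⟨y, k⟩`, whence
`λ⟨y, k⟩ ≤ ‖y‖²`, i.e. `-λ⟨Sk, k⟩ ≤ ε‖Sk‖²`. Finally `⟨Sk, k⟩ = -½ ∑_i ∫ (k∘Θ_i - k)²` and
`‖Sk‖² ≤ N ∑_i ∫ (k∘Θ_i - k)²`, so `(λ/2 - εN) ∑_i ∫ (k∘Θ_i - k)² ≤ 0` and the flip energy vanishes.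
No definitions.
-/

noncomputable section

open MeasureTheory Filter Topology
open scoped ContDiff InnerProductSpace

namespace Summit.AtomisticToContinuum.FouriersLaw.Theorems.NoiseLocality.StubResponseDensityNoisy

open Literature.MathematicalPhysics.KineticTheory.HeatConduction
open Summit.AtomisticToContinuum.FouriersLaw.Theorems.OddSectorIrreversibility

variable {ω₂ lam β γ : ℝ} {N : ℕ} {T : ℝ}

/-! ### Dissipativity of the equilibrium generator on test functions -/

/-- `L (f - g) = L f - L g` pointwise for `C²` functions. -/
theorem generator_sub (P : OscillatorChain) (N : ℕ) (T_L T_R : ℝ) {f g : PhaseSpace N → ℝ}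
    (hf : ContDiff ℝ 2 f) (hg : ContDiff ℝ 2 g) (x : PhaseSpace N) :
    P.generator N T_L T_R (fun y => f y - g y) x =
      P.generator N T_L T_R f x - P.generator N T_L T_R g x := by
  have e : (fun y => f y - g y) = fun y => f y + (-1) * g y := by
    funext y
    ring
  rw [e, generator_add P N T_L T_R hf (contDiff_const.mul hg) x, generator_const_mul P N T_L T_R (-1) g x]
  ring

/-- **Dissipativity of the equilibrium generator on test functions**: `∫ (L_{T,T} F) F dμ_T ≤ 0` for
`F ∈ C_c^∞` (pinned chain, `γ > 0`, `T > 0`): by the tap energy identity the left side is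
`-γT ∑_b ∫ (∂_{p_b}F)² e^{-H/T} / Z ≤ 0`. -/
theorem integral_generator_mul_self_nonpos (hω : 0 < ω₂) (hl : 0 ≤ lam) (hβ : 0 ≤ β) (hγ : 0 < γ)
    (hT : 0 < T) {F : PhaseSpace N → ℝ} (hF : ContDiff ℝ ∞ F) (hFc : HasCompactSupport F) :
    ∫ x, (pinnedChain ω₂ lam β γ).generator N T T F x * F x
      ∂((pinnedChain ω₂ lam β γ).gibbsMeasure N T) ≤ 0 := by
  set P := pinnedChain ω₂ lam β γ with hP
  haveI : IsProbabilityMeasure (P.gibbsMeasure N T) :=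
    pinnedChain_isProbabilityMeasure_gibbsMeasure hω hl hβ γ N hT
  have hF2 : ContDiff ℝ 2 F := hF.of_le (by norm_cast)
  have hLc : Continuous (P.generator N T T F) :=
    P.continuous_generator (pinnedChain_contDiff_U ω₂ lam β γ) (pinnedChain_contDiff_V ω₂ lam β γ)
      N T T hF2
  have hLs : HasCompactSupport (P.generator N T T F) := P.hasCompactSupport_generator N T T hF2 hFc
  have hFm : MemLp F 2 (P.gibbsMeasure N T) :=
    memLp_of_continuous_hasCompactSupport hF.continuous hFc _ 2
  have hkc : Continuous fun x => -P.generator N T T F x := hLc.neg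
  have hkm : MemLp (fun x => -P.generator N T T F x) 2 (P.gibbsMeasure N T) :=
    (memLp_of_continuous_hasCompactSupport hLc hLs _ 2).neg
  have h := Corrector.integral_mul_source_eq_dirichlet hω hl hβ hγ hT hF2 hFm hkc hkm
    (fun x => (neg_neg _).symm)
  have hnn : 0 ≤ γ * T * ∑ i : Fin N, OscillatorChain.bathWeight N i *
      ∫ x, partialP i F x ^ 2 * P.gibbsDensity N T x :=
    mul_nonneg (mul_nonneg hγ.le hT.le) (Finset.sum_nonneg fun i _ =>
      mul_nonneg (Corrector.bathWeight_nonneg N i)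
        (integral_nonneg fun x => mul_nonneg (sq_nonneg _) (P.gibbsDensity_pos N T x).le))
  rw [← h] at hnn
  rw [P.integral_gibbsMeasure]
  refine mul_nonpos_of_nonneg_of_nonpos (inv_nonneg.2 (integral_nonneg fun x => (P.gibbsDensity_pos N T x).le)) ?_
  have e : ∫ x, P.generator N T T F x * F x * P.gibbsDensity N T x =
      -∫ x, F x * (-P.generator N T T F x) * P.gibbsDensity N T x := by
    rw [← integral_neg]
    exact integral_congr_ae (Eventually.of_forall fun x => by ring)
  rw [e]
  exact neg_nonpos.2 hnn

/-- **Lower bound of the resolvent on test functions**: `λ ‖F‖ ≤ ‖λF - LF‖` in `L²(μ_T)` for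
`F ∈ C_c^∞` and real `λ` (`λ‖F‖² ≤ ⟨λF - LF, F⟩ ≤ ‖λF - LF‖ ‖F‖` by dissipativity). -/
theorem resolvent_lower_bound (hω : 0 < ω₂) (hl : 0 ≤ lam) (hβ : 0 ≤ β) (hγ : 0 < γ) (hT : 0 < T)
    (lam' : ℝ) {F : PhaseSpace N → ℝ} (hF : ContDiff ℝ ∞ F)
    (hFc : HasCompactSupport F) (hFm : MemLp F 2 ((pinnedChain ω₂ lam β γ).gibbsMeasure N T))
    (hRm : MemLp (fun x => lam' * F x - (pinnedChain ω₂ lam β γ).generator N T T F x) 2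
      ((pinnedChain ω₂ lam β γ).gibbsMeasure N T)) :
    lam' * ‖hFm.toLp F‖ ≤ ‖hRm.toLp _‖ := by
  set P := pinnedChain ω₂ lam β γ with hP
  haveI : IsProbabilityMeasure (P.gibbsMeasure N T) :=
    pinnedChain_isProbabilityMeasure_gibbsMeasure hω hl hβ γ N hT
  have hF2 : ContDiff ℝ 2 F := hF.of_le (by norm_cast)
  have hLm : MemLp (P.generator N T T F) 2 (P.gibbsMeasure N T) :=
    memLp_of_continuous_hasCompactSupport
      (P.continuous_generator (pinnedChain_contDiff_U ω₂ lam β γ) (pinnedChain_contDiff_V ω₂ lam β γ)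
        N T T hF2) (P.hasCompactSupport_generator N T T hF2 hFc) _ 2
  have iFF : Integrable (fun x => F x * F x) (P.gibbsMeasure N T) := hFm.integrable_mul hFm
  have iLF : Integrable (fun x => P.generator N T T F x * F x) (P.gibbsMeasure N T) :=
    hLm.integrable_mul hFm
  have h1 : ⟪hRm.toLp _, hFm.toLp F⟫_ℝ =
      lam' * ‖hFm.toLp F‖ ^ 2 - ∫ x, P.generator N T T F x * F x ∂(P.gibbsMeasure N T) := by
    rw [inner_toLp_toLp_eq_integral, ← real_inner_self_eq_norm_sq, inner_toLp_toLp_eq_integral,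
      ← integral_const_mul, ← integral_sub (iFF.const_mul lam') iLF]
    exact integral_congr_ae (Eventually.of_forall fun x => by ring)
  have h2 : lam' * ‖hFm.toLp F‖ ^ 2 ≤ ⟪hRm.toLp _, hFm.toLp F⟫_ℝ := by
    rw [h1]
    linarith [integral_generator_mul_self_nonpos hω hl hβ hγ hT hF hFc]
  have h3 : lam' * ‖hFm.toLp F‖ * ‖hFm.toLp F‖ ≤ ‖hRm.toLp _‖ * ‖hFm.toLp F‖ := by
    rw [mul_assoc, ← sq]
    exact h2.trans (real_inner_le_norm _ _)
  by_cases hφ : ‖hFm.toLp F‖ = 0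
  · rw [hφ, mul_zero]
    exact norm_nonneg _
  · exact le_of_mul_le_mul_right h3 (lt_of_le_of_ne (norm_nonneg _) (Ne.symm hφ))

/-! ### `L²` facts about the flips -/

/-- `S k ∈ L²(μ)` for `k ∈ L²(μ)` and a flip-invariant `μ`. -/
theorem memLp_flipNoise {μ : Measure (PhaseSpace N)} (hμ : ∀ i, MeasurePreserving (momentumFlip i) μ μ)
    {k : PhaseSpace N → ℝ} (hk : MemLp k 2 μ) : MemLp (flipNoise N k) 2 μ := by
  have e : flipNoise N k = fun x => ∑ i : Fin N, (k (momentumFlip i x) - k x) :=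
    funext fun x => flipNoise_eq N k x
  rw [e]
  exact memLp_finsetSum _ fun i _ => (hk.comp_measurePreserving (hμ i)).sub hk

/-! ### Zero flip energy of weak solutions -/

/-- **Weak `L²(μ_T)` solutions for `L_{T,T} + εS` have zero flip energy.** For the pinned chain
(`ω₂ > 0`, `lam, β ≥ 0`, `γ > 0`, `N ≥ 2`, `T > 0`), `ε > 0` and `k ∈ L²(μ_T)` with
`∫ (L_{T,T} f + ε S f) k dμ_T = 0` for every `f ∈ C_c^∞`: `∫ (k∘Θ_i - k)² dμ_T = 0` for every `i`.
See the module docstring for the proof. -/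
theorem flipEnergy_eq_zero_of_weak (hω : 0 < ω₂) (hl : 0 ≤ lam) (hβ : 0 ≤ β) (hγ : 0 < γ)
    (hN : 2 ≤ N) (hT : 0 < T) {ε : ℝ} (hε : 0 < ε) {k : PhaseSpace N → ℝ}
    (hk : MemLp k 2 ((pinnedChain ω₂ lam β γ).gibbsMeasure N T))
    (hweak : ∀ f : PhaseSpace N → ℝ, ContDiff ℝ ∞ f → HasCompactSupport f →
      ∫ x, (pinnedChain ω₂ lam β γ).flipGenerator N T T ε f x * k x
        ∂((pinnedChain ω₂ lam β γ).gibbsMeasure N T) = 0) :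
    ∀ i : Fin N, ∫ x, (k (momentumFlip i x) - k x) ^ 2
      ∂((pinnedChain ω₂ lam β γ).gibbsMeasure N T) = 0 := by
  classical
  set P := pinnedChain ω₂ lam β γ with hP
  set π := P.gibbsMeasure N T with hπ_def
  haveI hprob : IsProbabilityMeasure π := pinnedChain_isProbabilityMeasure_gibbsMeasure hω hl hβ γ N hT
  have hΘ : ∀ i : Fin N, MeasurePreserving (momentumFlip i) π π := fun i =>
    P.measurePreserving_momentumFlip_gibbsMeasure N T i
  have hU1 := pinnedChain_contDiff_U ω₂ lam β γ (n := 1)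
  have hV1 := pinnedChain_contDiff_V ω₂ lam β γ (n := 1)
  -- `L²` data
  have hkΘ : ∀ i : Fin N, MemLp (fun x => k (momentumFlip i x)) 2 π := fun i =>
    hk.comp_measurePreserving (hΘ i)
  have hdiff : ∀ i : Fin N, MemLp (fun x => k (momentumFlip i x) - k x) 2 π := fun i =>
    (hkΘ i).sub hk
  have hS : MemLp (flipNoise N k) 2 π := memLp_flipNoise hΘ hk
  set lam' : ℝ := 2 * N * ε + 1 with hlam_def
  have hlam : 0 < lam' := by positivity
  have hy : MemLp (fun x => lam' * k x + ε * flipNoise N k x) 2 π :=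
    (hk.const_mul lam').add (hS.const_mul ε)
  -- approximants
  have happrox : ∀ n : ℕ, ∃ F : PhaseSpace N → ℝ, ContDiff ℝ ∞ F ∧ HasCompactSupport F ∧
      ∫ x, ((lam' * k x + ε * flipNoise N k x) - (lam' * F x - P.generator N T T F x)) ^ 2 ∂π ≤
        (1 / ((n : ℝ) + 1)) ^ 2 := fun n =>
    exists_testFunction_resolvent_approx hω hl hβ hγ hN hT hlam hy (by positivity)
  choose F hFs hFc hFa using happrox
  have hF2 : ∀ n, ContDiff ℝ 2 (F n) := fun n => (hFs n).of_le (by norm_cast)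
  have hFm : ∀ n, MemLp (F n) 2 π := fun n =>
    memLp_of_continuous_hasCompactSupport (hFs n).continuous (hFc n) π 2
  have hLm : ∀ n, MemLp (P.generator N T T (F n)) 2 π := fun n =>
    memLp_of_continuous_hasCompactSupport (P.continuous_generator hU1 hV1 N T T (hF2 n))
      (P.hasCompactSupport_generator N T T (hF2 n) (hFc n)) π 2
  have hRm : ∀ n, MemLp (fun x => lam' * F n x - P.generator N T T (F n) x) 2 π := fun n =>
    ((hFm n).const_mul lam').sub (hLm n)
  -- vectors in `H = L²(π)`
  set φ : ℕ → Lp ℝ 2 π := fun n => (hFm n).toLp (F n) with hφ_def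
  set ψ : ℕ → Lp ℝ 2 π := fun n => (hRm n).toLp _ with hψ_def
  set η : Lp ℝ 2 π := hy.toLp _ with hη_def
  set κ : Lp ℝ 2 π := hk.toLp k with hκ_def
  set σ : Lp ℝ 2 π := hS.toLp (flipNoise N k) with hσ_def
  -- (1) `ψ n → η`
  have hψ : Tendsto ψ atTop (𝓝 η) := by
    rw [tendsto_iff_norm_sub_tendsto_zero]
    have hbd : ∀ n, ‖ψ n - η‖ ≤ 1 / ((n : ℝ) + 1) := by
      intro n
      have hsub : MemLp (fun x => (lam' * F n x - P.generator N T T (F n) x) -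
          (lam' * k x + ε * flipNoise N k x)) 2 π := (hRm n).sub hy
      have e : ψ n - η = hsub.toLp _ := (MemLp.toLp_sub (hRm n) hy).symm
      rw [e]
      have h := norm_toLp_le_sqrt hsub (C := (1 / ((n : ℝ) + 1)) ^ 2) (by
        refine le_trans (le_of_eq (integral_congr_ae (Eventually.of_forall fun x => ?_))) (hFa n)
        simp only
        ring)
      rwa [Real.sqrt_sq (by positivity)] at h
    exact squeeze_zero (fun n => norm_nonneg _) hbd tendsto_one_div_add_atTop_nhds_zero_nat
  -- (2) the lower bound makes `φ` Cauchy
  have hlow : ∀ n m, lam' * ‖φ n - φ m‖ ≤ ‖ψ n - ψ m‖ := by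
    intro n m
    have hFnm : ContDiff ℝ ∞ (fun x => F n x - F m x) := (hFs n).sub (hFs m)
    have hFnmc : HasCompactSupport (fun x => F n x - F m x) := (hFc n).sub (hFc m)
    have hsubm : MemLp (fun x => F n x - F m x) 2 π := (hFm n).sub (hFm m)
    have hRsub : MemLp (fun x => lam' * (F n x - F m x) -
        P.generator N T T (fun y => F n y - F m y) x) 2 π := by
      refine ((hRm n).sub (hRm m)).ae_eq (Eventually.of_forall fun x => ?_)
      simp only [Pi.sub_apply]
      rw [generator_sub P N T T (hF2 n) (hF2 m) x]
      ring
    have h := resolvent_lower_bound hω hl hβ hγ hT lam' hFnm hFnmc hsubm hRsub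
    have e1 : hsubm.toLp _ = φ n - φ m := MemLp.toLp_sub (hFm n) (hFm m)
    have e2 : hRsub.toLp _ = ψ n - ψ m := by
      rw [hψ_def, ← MemLp.toLp_sub]
      refine MemLp.toLp_congr _ _ (Eventually.of_forall fun x => ?_)
      simp only [Pi.sub_apply]
      rw [generator_sub P N T T (hF2 n) (hF2 m) x]
      ring
    rw [e1, e2] at h
    exact h
  have hφc : CauchySeq φ := by
    have hψc : CauchySeq ψ := hψ.cauchySeq
    rw [Metric.cauchySeq_iff] at hψc ⊢
    intro e he
    obtain ⟨M, hM⟩ := hψc (lam' * e) (by positivity)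
    refine ⟨M, fun n hn m hm => ?_⟩
    have h1 := hlow n m
    have h2 := hM n hn m hm
    rw [dist_eq_norm] at h2 ⊢
    exact lt_of_mul_lt_mul_left (h1.trans_lt h2) hlam.le
  obtain ⟨xv, hx⟩ := cauchySeq_tendsto_of_complete hφc
  -- (3) the weak equation along `F n`
  have hweak_n : ∀ n, lam' * ⟪φ n, κ⟫_ℝ - ⟪ψ n, κ⟫_ℝ + ε * ⟪φ n, σ⟫_ℝ = 0 := by
    intro n
    have h0 := hweak (F n) (hFs n) (hFc n)
    have iFk : Integrable (fun x => F n x * k x) π := (hFm n).integrable_mul hk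
    have iLk : Integrable (fun x => P.generator N T T (F n) x * k x) π := (hLm n).integrable_mul hk
    have hSF : MemLp (flipNoise N (F n)) 2 π := memLp_flipNoise hΘ (hFm n)
    have iSk : Integrable (fun x => flipNoise N (F n) x * k x) π := hSF.integrable_mul hk
    have hsplit : ∫ x, P.flipGenerator N T T ε (F n) x * k x ∂π =
        (∫ x, P.generator N T T (F n) x * k x ∂π) + ε * ∫ x, flipNoise N (F n) x * k x ∂π := by
      rw [← integral_const_mul, ← integral_add iLk (iSk.const_mul ε)]
      exact integral_congr_ae (Eventually.of_forall fun x => by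
        simp only [OscillatorChain.flipGenerator_eq_add_flipNoise]
        ring)
    have hsym : ∫ x, flipNoise N (F n) x * k x ∂π = ∫ x, F n x * flipNoise N k x ∂π :=
      (integral_mul_flipNoise hΘ iFk fun i => (hFm n).integrable_mul (hkΘ i)).symm
    have e1 : ⟪φ n, κ⟫_ℝ = ∫ x, F n x * k x ∂π := inner_toLp_toLp_eq_integral _ _
    have e2 : ⟪ψ n, κ⟫_ℝ = ∫ x, (lam' * F n x - P.generator N T T (F n) x) * k x ∂π :=
      inner_toLp_toLp_eq_integral _ _
    have e3 : ⟪φ n, σ⟫_ℝ = ∫ x, F n x * flipNoise N k x ∂π := inner_toLp_toLp_eq_integral _ _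
    have e4 : ∫ x, (lam' * F n x - P.generator N T T (F n) x) * k x ∂π =
        lam' * ∫ x, F n x * k x ∂π - ∫ x, P.generator N T T (F n) x * k x ∂π := by
      rw [← integral_const_mul, ← integral_sub (iFk.const_mul lam') iLk]
      exact integral_congr_ae (Eventually.of_forall fun x => by ring)
    rw [e1, e2, e3, e4, ← hsym]
    rw [hsplit] at h0
    linarith
  -- (4) pass to the limit
  have hlim_eq : lam' * ⟪xv, κ⟫_ℝ - ⟪η, κ⟫_ℝ + ε * ⟪xv, σ⟫_ℝ = 0 := by
    have h1 : Tendsto (fun n => lam' * ⟪φ n, κ⟫_ℝ - ⟪ψ n, κ⟫_ℝ + ε * ⟪φ n, σ⟫_ℝ) atTop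
        (𝓝 (lam' * ⟪xv, κ⟫_ℝ - ⟪η, κ⟫_ℝ + ε * ⟪xv, σ⟫_ℝ)) :=
      (((hx.inner tendsto_const_nhds).const_mul lam').sub (hψ.inner tendsto_const_nhds)).add
        ((hx.inner tendsto_const_nhds).const_mul ε)
    have h2 : Tendsto (fun n => lam' * ⟪φ n, κ⟫_ℝ - ⟪ψ n, κ⟫_ℝ + ε * ⟪φ n, σ⟫_ℝ) atTop (𝓝 0) := by
      simp only [hweak_n]
      exact tendsto_const_nhds
    exact tendsto_nhds_unique h1 h2
  -- `η = λ κ + ε σ`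
  have hη : η = lam' • κ + ε • σ := by
    rw [hη_def, hκ_def, hσ_def, ← MemLp.toLp_const_smul, ← MemLp.toLp_const_smul, ← MemLp.toLp_add]
    exact MemLp.toLp_congr _ _ (Eventually.of_forall fun x => by
      simp only [Pi.add_apply, Pi.smul_apply, smul_eq_mul])
  have hinner_eq : ⟪xv, η⟫_ℝ = ⟪η, κ⟫_ℝ := by
    have e : ⟪xv, η⟫_ℝ = lam' * ⟪xv, κ⟫_ℝ + ε * ⟪xv, σ⟫_ℝ := by
      rw [hη, inner_add_right, real_inner_smul_right, real_inner_smul_right]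
    rw [e]
    linarith
  -- (5) `λ ‖xv‖ ≤ ‖η‖`
  have hxbound : lam' * ‖xv‖ ≤ ‖η‖ :=
    le_of_tendsto_of_tendsto' ((hx.norm).const_mul lam') hψ.norm fun n =>
      resolvent_lower_bound hω hl hβ hγ hT lam' (hFs n) (hFc n) (hFm n) (hRm n)
  -- (6) `λ ⟨η, κ⟩ ≤ ‖η‖²`
  have hkey : lam' * ⟪η, κ⟫_ℝ ≤ ‖η‖ ^ 2 := by
    rw [← hinner_eq]
    calc lam' * ⟪xv, η⟫_ℝ ≤ lam' * (‖xv‖ * ‖η‖) :=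
          mul_le_mul_of_nonneg_left (real_inner_le_norm _ _) hlam.le
      _ = (lam' * ‖xv‖) * ‖η‖ := by ring
      _ ≤ ‖η‖ * ‖η‖ := mul_le_mul_of_nonneg_right hxbound (norm_nonneg _)
      _ = ‖η‖ ^ 2 := (sq _).symm
  have hηκ : ⟪η, κ⟫_ℝ = lam' * ‖κ‖ ^ 2 + ε * ⟪σ, κ⟫_ℝ := by
    rw [hη, inner_add_left, real_inner_smul_left, real_inner_smul_left, real_inner_self_eq_norm_sq]
  have hηη : ‖η‖ ^ 2 = lam' ^ 2 * ‖κ‖ ^ 2 + 2 * lam' * ε * ⟪σ, κ⟫_ℝ + ε ^ 2 * ‖σ‖ ^ 2 := by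
    rw [hη, norm_add_sq_real, norm_smul, norm_smul, real_inner_smul_left, real_inner_smul_right,
      Real.norm_eq_abs, Real.norm_eq_abs, abs_of_pos hlam, abs_of_pos hε, real_inner_comm σ κ]
    ring
  have hineq : -(lam' * ⟪σ, κ⟫_ℝ) ≤ ε * ‖σ‖ ^ 2 := by
    rw [hηκ, hηη] at hkey
    have h1 : 0 ≤ ε * (lam' * ⟪σ, κ⟫_ℝ + ε * ‖σ‖ ^ 2) := by nlinarith [hkey]
    have h2 := (mul_nonneg_iff_of_pos_left hε).1 h1
    linarith
  -- (7) flip algebra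
  set D : Fin N → ℝ := fun i => ∫ x, (k (momentumFlip i x) - k x) ^ 2 ∂π with hD_def
  have hD0 : ∀ i, 0 ≤ D i := fun i => integral_nonneg fun x => sq_nonneg _
  have hσκ : ⟪σ, κ⟫_ℝ = -(1 / 2) * ∑ i, D i := by
    rw [hσ_def, hκ_def, inner_toLp_toLp_eq_integral]
    have hterm : ∀ i : Fin N, ∫ x, (k (momentumFlip i x) - k x) * k x ∂π = -(1 / 2) * D i := by
      intro i
      have i1 : Integrable (fun x => k (momentumFlip i x) * k x) π := (hkΘ i).integrable_mul hk
      have i2 : Integrable (fun x => k x * k x) π := hk.integrable_mul hk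
      have i3 : Integrable (fun x => k (momentumFlip i x) * k (momentumFlip i x)) π :=
        (hkΘ i).integrable_mul (hkΘ i)
      have hsq : ∫ x, k (momentumFlip i x) * k (momentumFlip i x) ∂π = ∫ x, k x * k x ∂π :=
        integral_comp_momentumFlip (hΘ i) (fun x => k x * k x)
      have eD : D i = (∫ x, k (momentumFlip i x) * k (momentumFlip i x) ∂π) -
          2 * (∫ x, k (momentumFlip i x) * k x ∂π) + ∫ x, k x * k x ∂π := by
        have i4 : Integrable (fun x => 2 * (k (momentumFlip i x) * k x)) π := i1.const_mul 2
        have i5 : Integrable (fun x => k (momentumFlip i x) * k (momentumFlip i x) -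
            2 * (k (momentumFlip i x) * k x)) π := i3.sub i4
        have e : (fun x => (k (momentumFlip i x) - k x) ^ 2) = fun x =>
            (k (momentumFlip i x) * k (momentumFlip i x) - 2 * (k (momentumFlip i x) * k x)) +
              k x * k x := by
          funext x
          ring
        simp only [hD_def]
        rw [e, integral_add i5 i2, integral_sub i3 i4, integral_const_mul]
      have eL : ∫ x, (k (momentumFlip i x) - k x) * k x ∂π =
          (∫ x, k (momentumFlip i x) * k x ∂π) - ∫ x, k x * k x ∂π := by
        rw [← integral_sub i1 i2]
        exact integral_congr_ae (Eventually.of_forall fun x => by ring)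
      rw [eL, eD, hsq]
      ring
    calc ∫ x, flipNoise N k x * k x ∂π
        = ∫ x, ∑ i : Fin N, (k (momentumFlip i x) - k x) * k x ∂π :=
          integral_congr_ae (Eventually.of_forall fun x => by
            simp only [flipNoise_eq, Finset.sum_mul])
      _ = ∑ i : Fin N, ∫ x, (k (momentumFlip i x) - k x) * k x ∂π :=
          integral_finsetSum _ fun i _ => (hdiff i).integrable_mul hk
      _ = ∑ i : Fin N, (-(1 / 2) * D i) := Finset.sum_congr rfl fun i _ => hterm i
      _ = -(1 / 2) * ∑ i, D i := by rw [Finset.mul_sum]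
  have hσσ : ‖σ‖ ^ 2 ≤ N * ∑ i, D i := by
    rw [← real_inner_self_eq_norm_sq, hσ_def, inner_toLp_toLp_eq_integral]
    have hpt : ∀ x, flipNoise N k x * flipNoise N k x ≤
        N * ∑ i : Fin N, (k (momentumFlip i x) - k x) ^ 2 := by
      intro x
      rw [flipNoise_eq, ← sq]
      have h := sq_sum_le_card_mul_sum_sq (s := Finset.univ)
        (f := fun i : Fin N => k (momentumFlip i x) - k x)
      simpa [Finset.card_univ, Fintype.card_fin] using h
    have iS2 : Integrable (fun x => flipNoise N k x * flipNoise N k x) π := hS.integrable_mul hS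
    have iD0 : Integrable (fun x => ∑ i : Fin N, (k (momentumFlip i x) - k x) ^ 2) π :=
      integrable_finsetSum _ fun i _ => (hdiff i).integrable_sq
    calc ∫ x, flipNoise N k x * flipNoise N k x ∂π
        ≤ ∫ x, (N : ℝ) * ∑ i : Fin N, (k (momentumFlip i x) - k x) ^ 2 ∂π :=
          integral_mono iS2 (iD0.const_mul _) hpt
      _ = N * ∑ i, D i := by
          rw [integral_const_mul, integral_finsetSum _ fun i _ => (hdiff i).integrable_sq]
  -- (8) conclusion
  have hsum : ∑ i, D i = 0 := by
    have hS0 : 0 ≤ ∑ i, D i := Finset.sum_nonneg fun i _ => hD0 i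
    rw [hσκ] at hineq
    have h2 : ε * ‖σ‖ ^ 2 ≤ ε * (N * ∑ i, D i) := mul_le_mul_of_nonneg_left hσσ hε.le
    have h3 : lam' / 2 * ∑ i, D i ≤ ε * N * ∑ i, D i := by linarith [hineq, h2]
    rw [hlam_def] at h3
    have h4 : ∑ i, D i ≤ 0 := by linarith
    exact le_antisymm h4 hS0
  intro i
  have h := (Finset.sum_eq_zero_iff_of_nonneg fun i _ => hD0 i).1 hsum i (Finset.mem_univ i)
  simpa only [hD_def] using h

/-! ### Registered helper sub-goal (stub form, one line) -/

/-- Registered helper sub-goal `helper_responseDensityNoisyFlipEnergyZero` of stub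
`stub_responseDensityNoisy` (= `flipEnergy_eq_zero_of_weak` in stub form): weak `L²(μ_T)` solutions for
the flip-noisy equilibrium generator have zero flip energy. -/
theorem helper_responseDensityNoisyFlipEnergyZero : ∀ ω₂ lam β γ : ℝ, 0 < ω₂ → 0 ≤ lam → 0 ≤ β → 0 < γ → ∀ (N : ℕ), 2 ≤ N → ∀ (T : ℝ), 0 < T → ∀ (ε : ℝ), 0 < ε → ∀ k : Literature.MathematicalPhysics.KineticTheory.HeatConduction.PhaseSpace N → ℝ, MeasureTheory.MemLp k 2 ((Literature.MathematicalPhysics.KineticTheory.HeatConduction.pinnedChain ω₂ lam β γ).gibbsMeasure N T) → (∀ f : Literature.MathematicalPhysics.KineticTheory.HeatConduction.PhaseSpace N → ℝ, ContDiff ℝ ((⊤ : ℕ∞) : WithTop ℕ∞) f → HasCompactSupport f → ∫ x, (Literature.MathematicalPhysics.KineticTheory.HeatConduction.pinnedChain ω₂ lam β γ).flipGenerator N T T ε f x * k x ∂((Literature.MathematicalPhysics.KineticTheory.HeatConduction.pinnedChain ω₂ lam β γ).gibbsMeasure N T) = 0) → ∀ i : Fin N, ∫ x, (k (Literature.MathematicalPhysics.KineticTheory.HeatConduction.momentumFlip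 i x) - k x) ^ 2 ∂((Literature.MathematicalPhysics.KineticTheory.HeatConduction.pinnedChain ω₂ lam β γ).gibbsMeasure N T) = 0 :=
  fun _ _ _ _ hω hl hβ hγ _ hN _ hT _ hε _ hk hweak => flipEnergy_eq_zero_of_weak hω hl hβ hγ hN hT hε hk hweak

end Summit.AtomisticToContinuum.FouriersLaw.Theorems.NoiseLocality.StubResponseDensityNoisy

end
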